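import Mathlib
import HarnessLib
import Literature.Probability.MarkovChains.StationaryStructureFinite

/-!
# `E[ρ_j | X_0 = j] = Σ_m m f(m)_{jj} = Σ_t P(ρ_j > t | X_0 = j)` and Kac's formula `(μ)_j E[ρ_j | X_0 = j] = 1` on every essential class of a finite chain (Stroock 2014, (2.3.9), §4.1.2–4.1.3)

HONEST FRAMING: exact (Metropolis-corrected) sampling algorithms for lattice gauge theory; figures
of merit are autocorrelation/cost numbers at stated couplings and volumes; no continuum-physics claim.

SOURCE (read on the hub's materialised pages): D. W. Stroock, *An Introduction to Markov Processes*,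
2nd ed., GTM **230**, Springer 2014 [Stroock2014]: §4.1.2 ("`Σ_{m=1}^∞ m f(m)_{jj} = E[ρ_j | X_0 =
j]`", "`π_{jj} = (E[ρ_j | X_0 = j])⁻¹`"), §2.3.3 eq. **(2.3.9)** ("`(π)_j E[ρ_j | X_0 = j] = 1`", printed
under Doeblin's condition), §4.1.3 eq. (4.1.9) ∕ Theorem 4.1.10 (`(π^C)_i = π_{ii}` on a positive
recurrent class), and §2.3.2 Theorem 2.3.8's proof ("`N P(ρ_j > N) → 0`" from the geometric tail).

SETTING AND DECLARED ROUTE: FINITE state space, the tree's vocabulary.  The tree's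
`Stroock2014_eq_2_3_9` (`DoeblinKacFormula.lean`) proves Kac's formula under Doeblin's GLOBAL
condition at `j`; here the same identities are obtained for every ESSENTIAL state `j` of an arbitrary
finite chain (transient states elsewhere allowed), from Lemma 3.1.9's class bound
`P(ρ_j > nM | X_0 = j) ≤ θⁿ` (`RecurrenceClassesFinite.lean`) and (4.1.8) ∕ (4.1.9)
(`StationaryStructureFinite.lean`).

* `tendsto_mul_avoidProb_of_isEssential` — `N·P(ρ_j > N | X_0 = j) → 0`;
* `hasSum_mul_firstPassageProb_of_isEssential` — **`Σ_m m f(m)_{jj} = Σ_t P(ρ_j > t | X_0 = j)`**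
  (Abel summation), `abelLimit_eq_inv_tsum_avoidProb` (`π_{jj} = (Σ_t P(ρ_j > t | j))⁻¹`);
* **Kac's formula on a class** `Stroock2014_eq_2_3_9_class` — for a non-negative stationary `μ` with
  `Σ_{i∈[j]} (μ)_i = 1` and `j` essential, `(μ)_j · E[ρ_j | X_0 = j] = 1` (tail-sum form), and
  `Stroock2014_eq_2_3_9_finite` — for the stationary probability vector of a chain with a single
  essential class (Exercise 2.4.5, the doubly stochastic case, is the tree's `Stroock2014_ex_2_4_5`,
  `ReturnTimeTransienceCriterion.lean`).

Everything is PROVED (0 named facts).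
-/

namespace Literature.Probability.MarkovChains

open Finset Matrix Filter Topology

variable {X : Type*} [Fintype X] [DecidableEq X]

/-- **`N·P(ρ_j > N | X_0 = j) → 0`** for an essential state of a finite chain
(`N P(ρ_j > N) ≤ M(⌊N/M⌋ + 1)θ^{⌊N/M⌋}`). [cite: Stroock2014, §2.3.2 Theorem 2.3.8 (proof);
§3.1.2 Lemma 3.1.9] -/
theorem tendsto_mul_avoidProb_of_isEssential {P : Matrix X X ℝ} (hP : IsRowStochastic P) {j : X}
    (hj : IsEssential P j) :
    Tendsto (fun N : ℕ => (N : ℝ) * avoidProb P j N j) atTop (𝓝 0) := by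
  obtain ⟨M, θ, hθ0, hθ1, hθ⟩ := exists_uniform_avoidProb_lt_one hP hj (self_mem_commClass j)
  have hM : M ≠ 0 := by
    rintro rfl
    have := hθ j (self_mem_commClass j)
    rw [avoidProb_zero] at this
    linarith
  have hMpos : 0 < M := Nat.pos_of_ne_zero hM
  have hg0 : Tendsto (fun n : ℕ => (n : ℝ) * θ ^ n) atTop (𝓝 0) :=
    tendsto_self_mul_const_pow_of_lt_one hθ0 hθ1
  have hg1 : Tendsto (fun n : ℕ => (M : ℝ) * (((n : ℝ) * θ ^ n) + θ ^ n)) atTop (𝓝 0) := by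
    have := (hg0.add (tendsto_pow_atTop_nhds_zero_of_lt_one hθ0 hθ1)).const_mul (M : ℝ)
    simpa using this
  have hg := hg1.comp (Nat.tendsto_div_const_atTop hM)
  refine squeeze_zero (fun N => mul_nonneg (Nat.cast_nonneg N) (avoidProb_nonneg hP j N j))
    (fun N => ?_) hg
  have hN : (N : ℝ) ≤ M * ((N / M : ℕ) + 1 : ℝ) := by
    have h := Nat.lt_div_mul_add hMpos (a := N)
    have : (N : ℝ) < ((N / M : ℕ) : ℝ) * M + M := by exact_mod_cast h
    nlinarith
  have hu' := avoidProb_mul_le_pow_of_isEssential hP hj hθ (N / M) (self_mem_commClass j)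
  have hu : avoidProb P j N j ≤ θ ^ (N / M) :=
    (avoidProb_antitone hP j j (Nat.div_mul_le_self N M)).trans hu'
  have hu0 : 0 ≤ avoidProb P j N j := avoidProb_nonneg hP j N j
  calc (N : ℝ) * avoidProb P j N j ≤ (M * ((N / M : ℕ) + 1 : ℝ)) * θ ^ (N / M) :=
        mul_le_mul hN hu hu0 (by positivity)
    _ = (M : ℝ) * ((((N / M : ℕ) : ℝ) * θ ^ (N / M)) + θ ^ (N / M)) := by ring

/-- **`E[ρ_j | X_0 = j] = Σ_{m≥1} m f(m)_{jj} = Σ_{t≥0} P(ρ_j > t | X_0 = j)`** for an essential state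
of a finite chain (let `N → ∞` in `Σ_{m≤N} m f(m) = Σ_{t<N} P(ρ_j > t) − N P(ρ_j > N)`).
[cite: Stroock2014, §4.1.2 ("`Σ_{m=1}^∞ m f(m)_{jj} = E[ρ_j | X_0 = j]`")] -/
theorem hasSum_mul_firstPassageProb_of_isEssential {P : Matrix X X ℝ} (hP : IsRowStochastic P)
    {j : X} (hj : IsEssential P j) :
    HasSum (fun m : ℕ => (m : ℝ) * firstPassageProb P j m j) (∑' t, avoidProb P j t j) := by
  have hs : Summable fun t => avoidProb P j t j :=
    (Stroock2014_ex_2_4_4 hP j).mp (recurrent_of_isEssential hP hj)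
  rw [hasSum_iff_tendsto_nat_of_nonneg
    (fun m : ℕ => mul_nonneg (Nat.cast_nonneg m) (firstPassageProb_nonneg hP j m j))]
  refine (tendsto_add_atTop_iff_nat 1).mp ?_
  have h : (fun N => ∑ m ∈ range (N + 1), (m : ℝ) * firstPassageProb P j m j) =
      fun N => ∑ t ∈ range N, avoidProb P j t j - N * avoidProb P j N j :=
    funext (sum_mul_firstPassageProb P j j)
  rw [h]
  simpa using hs.hasSum.tendsto_sum_nat.sub (tendsto_mul_avoidProb_of_isEssential hP hj)

/-- **`π_{jj} = 1/E[ρ_j | X_0 = j]`** with the expectation in tail-sum form, for an essential state of a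
finite chain. [cite: Stroock2014, §4.1.2 eq. (4.1.5) ("`π_{jj} = (E[ρ_j | X_0 = j])⁻¹`")] -/
theorem abelLimit_eq_inv_tsum_avoidProb {P : Matrix X X ℝ} (hP : IsRowStochastic P) {j : X}
    (hj : IsEssential P j) : abelLimit P j = (∑' t, avoidProb P j t j)⁻¹ := by
  rw [(abelLimit_pos_of_isEssential hP hj).2,
    (hasSum_mul_firstPassageProb_of_isEssential hP hj).tsum_eq]

/-- **(2.3.9) on an essential class, finite chains**: if `μ ≥ 0` is stationary with `Σ_{i∈[j]} (μ)_i
= 1` and `j` is essential, then `(μ)_j · E[ρ_j | X_0 = j] = 1` (`E[ρ_j | X_0 = j] = Σ_t P(ρ_j > t |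
X_0 = j)`). [cite: Stroock2014, §2.3.3 eq. (2.3.9); §4.1.3 eq. (4.1.9)] -/
theorem Stroock2014_eq_2_3_9_class {P : Matrix X X ℝ} (hP : IsRowStochastic P) {μ : X → ℝ}
    (hμ : IsStationary μ P) (hμ0 : ∀ x, 0 ≤ μ x) {j : X} (hj : IsEssential P j)
    (hμ1 : ∑ i ∈ commClass P j, μ i = 1) :
    μ j * ∑' t, avoidProb P j t j = 1 := by
  have h := (Stroock2014_eq_4_1_9_kac hP hμ hμ0 hμ1).1
  rw [h, abelLimit_eq_inv_tsum_avoidProb hP hj]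
  have hpos : 0 < ∑' t, avoidProb P j t j := by
    have h1 := one_le_meanReturnTime hP (recurrent_of_isEssential hP hj)
      (summable_mul_firstPassageProb_of_isEssential hP hj)
    rw [(hasSum_mul_firstPassageProb_of_isEssential hP hj).tsum_eq] at h1
    linarith
  exact inv_mul_cancel₀ hpos.ne'

/-- **(2.3.9) for a finite chain with a single essential class**: every stationary probability
vector `π` has `(π)_j · E[ρ_j | X_0 = j] = 1` at every essential `j`, and `(π)_j = 0` at every
transient `j`. [cite: Stroock2014, §2.3.3 eq. (2.3.9); §4.1.3 Theorem 4.1.10]; [cite: LevinPeres2017,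
§1.7 Prop. 1.29] -/
theorem Stroock2014_eq_2_3_9_finite {P : Matrix X X ℝ} (hP : IsRowStochastic P)
    (huniq : ∀ x y, IsEssential P x → IsEssential P y → Communicates P x y) {π : X → ℝ}
    (hπ : IsStationary π P) (hπ0 : ∀ x, 0 ≤ π x) (hπ1 : ∑ x, π x = 1) (j : X) :
    (IsEssential P j → π j * ∑' t, avoidProb P j t j = 1) ∧ (¬ IsEssential P j → π j = 0) := by
  refine ⟨fun hj => Stroock2014_eq_2_3_9_class hP hπ hπ0 hj ?_,
    fun hj => LevinPeres2017_prop_1_28 hP hπ hπ0 hj⟩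
  -- all the mass sits on the unique essential class `[j]`
  rw [← hπ1]
  refine sum_subset (subset_univ _) fun i _ hi => ?_
  by_contra hne
  have hipos : 0 < π i := lt_of_le_of_ne (hπ0 i) (Ne.symm hne)
  have hi_ess : IsEssential P i := by
    by_contra h; exact hne (LevinPeres2017_prop_1_28 hP hπ hπ0 h)
  exact hi (mem_commClass.mpr (huniq j i hj hi_ess))

end Literature.Probability.MarkovChains
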